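import Literature.AlgebraicGeometry.Resolution.NeronPopescuSingularIdeal
import Mathlib.RingTheory.Smooth.Pi
import Mathlib.RingTheory.Finiteness.FinitePresentationLocal
import Mathlib.RingTheory.Ideal.Quotient.Operations
import Mathlib.RingTheory.Ideal.Over
import HarnessLib

/-!
# PT for a finite product of ring maps (Stacks 07F3)

Topic: `Literature/AlgebraicGeometry/Resolution`. Groundwork for the proof of the named fact
`Stacks07F5_reduceToField` (`NeronPopescuSteps.lean`). Stacks, *Smoothing Ring Maps*,
Lemma 07F3: "Let `R_i → Λ_i`, `i = 1, 2` be as in Situation 07F2. If PT holds for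
`R_i → Λ_i`, `i = 1, 2`, then PT holds for `R₁ × R₂ → Λ₁ × Λ₂`." (Proof: "Omitted. Hint: A
product of filtered colimits is a filtered colimit.") In the proof of 07F5 it is applied to
the total ring of fractions `Q = S⁻¹R = K₁ × … × K_n` of a reduced Noetherian ring and
`S⁻¹Λ = ∏ K_i ⊗_R Λ`.

We PROVE the `n`-ary statement in the factorisation form of PT (`HasSmoothFactorizations`,
Algebra 07C3) and in the internal ("Chinese remainder") description of a finite product
decomposition, which is the form in which `Q = ∏ Q/𝔪_i` arises: for pairwise coprime ideals
`𝔪_i` of `R` with `⋂ 𝔪_i = 0` (so that `R = ∏ R/𝔪_i` and `Λ = ∏ Λ/𝔪_iΛ`), PT for every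
`R/𝔪_i → Λ/𝔪_iΛ` implies PT for `R → Λ`:
`HasSmoothFactorizations.of_pairwise_isCoprime`. The proof is the evident one: a finite type
`A → Λ` induces `A/𝔪_iA → Λ/𝔪_iΛ` over `R/𝔪_i`, which factor through smooth
`R/𝔪_i`-algebras `C_i`; then `C = ∏ C_i` is smooth over `R` (each `R/𝔪_i` is smooth over
`R = ∏ R/𝔪_j`, and finite products of smooth algebras are smooth — Mathlib's
`Algebra.FormallySmooth.pi_iff`, `Algebra.FinitePresentation.pi`) and `A → C → ∏ Λ/𝔪_iΛ = Λ`
is the required factorisation. No new notions, no named facts.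

## Sources

* The Stacks Project, *Smoothing Ring Maps* (Tag 07BW), Lemma 07F3, and the proof of
  Lemma 07F5 ("We know that `Q = K₁ × … × K_n` is a product of fields … By Lemma 07F3 and our
  assumption PT holds for the ring map `S⁻¹R → S⁻¹Λ`"); *Algebra*, Lemma 00DT (Chinese
  remainder). [StacksProject]
-/

noncomputable section

namespace Literature.AlgebraicGeometry.Resolution

universe u

section Product

variable {R Λ : Type u} [CommRing R] [CommRing Λ] [Algebra R Λ]

/-- For pairwise coprime ideals `𝔪_i` with `⋂ 𝔪_i = 0`, the map `R → ∏ R/𝔪_i` is bijective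
(Chinese remainder theorem). [cite: StacksProject, Tag 00DT] -/
theorem bijective_pi_quotient_mk {ι : Type u} [Finite ι] (m : ι → Ideal R)
    (hm : Pairwise (Function.onFun IsCoprime m)) (hinf : ⨅ i, m i = ⊥) :
    Function.Bijective (AlgHom.pi (R := R) (A := fun i => R ⧸ m i) fun i => Ideal.Quotient.mkₐ R (m i)) := by
  constructor
  · intro x y hxy
    rw [← sub_eq_zero, ← Ideal.mem_bot, ← hinf, Ideal.mem_iInf]
    intro i
    exact Ideal.Quotient.eq.mp (congr_fun hxy i)
  · intro g
    obtain ⟨r, hr⟩ := Ideal.pi_quotient_surjective hm g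
    exact ⟨r, funext hr⟩

/-- Extensions of pairwise coprime ideals are pairwise coprime. [folklore] -/
theorem pairwise_isCoprime_map {ι : Type u} (m : ι → Ideal R)
    (hm : Pairwise (Function.onFun IsCoprime m)) :
    Pairwise (Function.onFun IsCoprime fun i => (m i).map (algebraMap R Λ)) := by
  intro i j hij
  have h := hm hij
  rw [Function.onFun, Ideal.isCoprime_iff_sup_eq] at h ⊢
  rw [← Ideal.map_sup, h, Ideal.map_top]

/-- If pairwise coprime ideals `𝔪_i` of `R` intersect in `0`, so do their extensions `𝔪_iΛ`
(`⋂ 𝔪_iΛ = ∏ 𝔪_iΛ = (∏ 𝔪_i)Λ = 0`). [folklore] -/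
theorem iInf_map_eq_bot {ι : Type u} [Finite ι] (m : ι → Ideal R)
    (hm : Pairwise (Function.onFun IsCoprime m)) (hinf : ⨅ i, m i = ⊥) :
    ⨅ i, (m i).map (algebraMap R Λ) = ⊥ := by
  classical
  cases nonempty_fintype ι
  have hprod : ∏ i, m i = ⊥ := by
    refine le_bot_iff.mp (le_trans Ideal.prod_le_inf ?_)
    rw [← hinf]
    exact le_iInf fun i => Finset.inf_le (Finset.mem_univ i)
  have hmΛ := pairwise_isCoprime_map (Λ := Λ) m hm
  have h1 : ⨅ i, (m i).map (algebraMap R Λ) = ⨅ i ∈ (Finset.univ : Finset ι),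
      (m i).map (algebraMap R Λ) := by simp
  rw [h1, ← Ideal.prod_eq_iInf_of_pairwise_isCoprime fun i _ j _ hij => hmΛ hij]
  have h2 : ∏ i, (m i).map (algebraMap R Λ) = (∏ i, m i).map (algebraMap R Λ) :=
    (map_prod (Ideal.mapHom (algebraMap R Λ)) m Finset.univ).symm
  rw [h2, hprod, Ideal.map_bot]

/-- **Stacks 07F3 (PT for finite products), `n`-ary, in Chinese-remainder form.** Let `R` be
Noetherian, `𝔪_i` (`i ∈ ι` finite) pairwise coprime ideals of `R` with `⋂ 𝔪_i = 0`, so that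
`R = ∏ R/𝔪_i` and `Λ = ∏ Λ/𝔪_iΛ`. If PT holds for every `R/𝔪_i → Λ/𝔪_iΛ` then PT holds for
`R → Λ`: a finite type `A → Λ` induces `A/𝔪_iA → Λ/𝔪_iΛ`, which factor through smooth
`R/𝔪_i`-algebras `C_i`, and `A → ∏ C_i → ∏ Λ/𝔪_iΛ = Λ` with `∏ C_i` smooth over `R`.
[cite: StacksProject, Tag 07F3] -/
theorem HasSmoothFactorizations.of_pairwise_isCoprime [IsNoetherianRing R] {ι : Type u}
    [Finite ι] (m : ι → Ideal R) (hm : Pairwise (Function.onFun IsCoprime m))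
    (hinf : ⨅ i, m i = ⊥)
    (h : ∀ i, HasSmoothFactorizations (R ⧸ m i) (Λ ⧸ (m i).map (algebraMap R Λ))) :
    HasSmoothFactorizations R Λ := by
  classical
  cases nonempty_fintype ι
  intro A _ _ hA φ
  haveI := hA
  -- the induced maps `A/𝔪_iA → Λ/𝔪_iΛ` over `R/𝔪_i`
  have hle : ∀ i, (m i).map (algebraMap R A) ≤ ((m i).map (algebraMap R Λ)).comap φ := by
    intro i
    rw [Ideal.map_le_iff_le_comap]
    intro r hr
    rw [Ideal.mem_comap, Ideal.mem_comap, AlgHom.commutes]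
    exact Ideal.mem_map_of_mem _ hr
  let φq : ∀ i, (A ⧸ (m i).map (algebraMap R A)) →ₐ[R ⧸ m i]
      (Λ ⧸ (m i).map (algebraMap R Λ)) := fun i =>
    AlgHom.extendScalarsOfSurjective (Ideal.Quotient.mk_surjective (I := m i))
      (Ideal.quotientMapₐ ((m i).map (algebraMap R Λ)) φ (hle i))
  have hAq : ∀ i, Algebra.FiniteType (R ⧸ m i) (A ⧸ (m i).map (algebraMap R A)) := fun i =>
    Algebra.FiniteType.of_restrictScalars_finiteType R (R ⧸ m i) _
  -- smooth factorisations of the components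
  choose C instC instA hC using fun i => h i (A ⧸ (m i).map (algebraMap R A)) (hAq i) (φq i)
  letI : ∀ i, CommRing (C i) := instC
  letI : ∀ i, Algebra (R ⧸ m i) (C i) := instA
  have hCs : ∀ i, Algebra.Smooth (R ⧸ m i) (C i) := fun i => (hC i).1
  choose v w hvw using fun i => (hC i).2
  -- `C_i` as smooth `R`-algebras
  letI : ∀ i, Algebra R (C i) := fun i =>
    ((algebraMap (R ⧸ m i) (C i)).comp (Ideal.Quotient.mk (m i))).toAlgebra
  haveI : ∀ i, IsScalarTower R (R ⧸ m i) (C i) := fun i =>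
    IsScalarTower.of_algebraMap_eq fun _ => rfl
  let eR : R ≃ₐ[R] (∀ i, R ⧸ m i) := AlgEquiv.ofBijective _ (bijective_pi_quotient_mk m hm hinf)
  haveI : Algebra.FormallySmooth R (∀ i, R ⧸ m i) := Algebra.FormallySmooth.of_equiv eR
  haveI : ∀ i, Algebra.FormallySmooth R (R ⧸ m i) := fun i =>
    Algebra.FormallySmooth.of_pi (fun j => R ⧸ m j) i
  haveI : ∀ i, Algebra.FinitePresentation R (R ⧸ m i) := fun i =>
    Algebra.FinitePresentation.quotient (IsNoetherian.noetherian (m i))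
  haveI : ∀ i, Algebra.Smooth R (R ⧸ m i) := fun i => ⟨inferInstance, inferInstance⟩
  haveI : ∀ i, Algebra.Smooth (R ⧸ m i) (C i) := hCs
  haveI : ∀ i, Algebra.Smooth R (C i) := fun i => Algebra.Smooth.comp R (R ⧸ m i) (C i)
  haveI : ∀ i, Algebra.FormallySmooth R (C i) := fun i => Algebra.Smooth.formallySmooth
  haveI : ∀ i, Algebra.FinitePresentation R (C i) := fun i => Algebra.Smooth.finitePresentation
  have hCsmooth : Algebra.Smooth R (∀ i, C i) := ⟨inferInstance, inferInstance⟩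
  -- `Λ = ∏ Λ/𝔪_iΛ`
  let eΛ : Λ ≃ₐ[R] (∀ i, Λ ⧸ (m i).map (algebraMap R Λ)) :=
    AlgEquiv.ofBijective _ (bijective_pi_quotient_mk (R := Λ) _
      (pairwise_isCoprime_map m hm) (iInf_map_eq_bot m hm hinf)) |>.restrictScalars R
  -- the factorisation `A → ∏ C_i → Λ`
  let v' : A →ₐ[R] (∀ i, C i) := AlgHom.pi fun i =>
    ((v i).restrictScalars R).comp (Ideal.Quotient.mkₐ R ((m i).map (algebraMap R A)))
  let w₀ : (∀ i, C i) →ₐ[R] (∀ i, Λ ⧸ (m i).map (algebraMap R Λ)) :=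
    AlgHom.pi fun i => ((w i).restrictScalars R).comp (Pi.evalAlgHom R C i)
  let w' : (∀ i, C i) →ₐ[R] Λ := (eΛ.symm : _ →ₐ[R] Λ).comp w₀
  refine ⟨∀ i, C i, inferInstance, inferInstance, hCsmooth, v', w', ?_⟩
  ext a
  apply eΛ.injective
  change eΛ (eΛ.symm (w₀ (v' a))) = eΛ (φ a)
  rw [AlgEquiv.apply_symm_apply]
  funext i
  change w i (v i (Ideal.Quotient.mk _ a)) = Ideal.Quotient.mk _ (φ a)
  exact AlgHom.congr_fun (hvw i) (Ideal.Quotient.mk _ a)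

end Product

end Literature.AlgebraicGeometry.Resolution

end
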